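import Mathlib
import HarnessLib
import Summits.HubbardSuperconductivity.HubbardSuperconductivity.Theorems.KLProgrammeKLRegimeEngineTwoLegStepV17F2ClosersGridBinderC

/-!
# Route `KLProgramme` — ENGINE child gen 8 (stmt-HubbardSuperconductivity-20437 `KLRegimeEngineV17F2`), stub (e) under the (T′-B) text (token #27
# `TwoLegGridMomentsAtC`): the (e) CLOSER TWIN in GENERIC-THRESHOLD FORM — currency literals as CLOSED (P R)-terms of any size ((R60g)(4))
# (cell gate-hubbard-kl, seat hubbard-kl-r2d-p1 g9; sequel of p574586 `…ClosersGridBinderC`)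

WHY.  Under (T′-B) the producer's base literals at the flow frame are `Zt⁽⁰⁾ = 2¹⁰e¹⁸κ₀⁴(1+ε_R)²·klE3A1 R`, `Zs₂⁽⁰⁾ = 2¹¹e¹⁸κ₀⁴(1+ε_R)²·klE3A1 R`,
`ε_R = κ_R/(4e⁴κ₀²)` (k3c2-p1, KL STATUS 2026-08-27 l.3911): they fit under the (A) literals `2^{10|11}e¹⁸κ₀⁴·klE3Acum R = …·2⁴⁰·klE3A1 R` iff `(1+ε_R)² ≤ 2⁴⁰`,
which is NOT provable for every admissible `R` (`R.WF2` does not bound the `Gfr j`, hence not `κ_R`).  So the registered literals must be the producers' CLOSED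
(P R)-terms (`klZt`, `klZs1`, `klZs2`) and the (e) closer may not assume «≤ literal» rows: p574586's `hZa`/`hS₂a` are replaced here by the U-rows
`hUm : U ≤ klTwoLegMomU R Zt Zs₂` (the landed generic door, …TwoLegMomentsExport §2a) and `hUq : U ≤ 1/(64·(|Zs₂|+1))` — both fold into `klEngU₀11`'s min-list
keyed on the literal defs —, keeping the #28 row `hrow` (closer-internal, from `klEngC₃7`/`klEngU₀11` via `mixedRow_of_thresholds`).

* `mixed_fits_of_le_klTwoLegMomU` (B1′ `Zt·U² ≤ cz|U|`, B2′ `Zs₁ĉ|U| + Zs₂U² + 4/3Gfr₁U² ≤ cz|U|·cDt/2`, no sign/size hypothesis on `Zt, Zs₂`),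
  `twoLeg_gridLegSmallnessC_of_generic_doors`, **`stub_twoLeg_step_of_gridBinderC_dualRows_raise_thr`** ⟹ `TwoLegStepV17F2 L M klEngGeo8 P Q R β U μ n`.

Proofs only; no definitions; nothing about the model is asserted; nothing asserts any stub of 20437, K3 or superconductivity.
References: BGM 2006 §2.4 (2.23), (2.36), §3 [cite: BenfattoGiulianiMastropietro2006].
-/

noncomputable section

namespace Summit.HubbardSuperconductivity.HubbardSuperconductivity.Theorems.EngineV8

set_option linter.dupNamespace false -- summit = problem name (single-conjunct summit), D-0017

open Real Finset Complex Literature.MathematicalPhysics.QuantumLattice Literature.Probability.LatticeModels GrassmannAlgebra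
open Literature.MathematicalPhysics.QuantumLattice.FermiRG Literature.MathematicalPhysics.QuantumLattice.BandSectorCounting
open Summit.HubbardSuperconductivity.HubbardSuperconductivity.Theorems.KLProgrammeLegKernels
open Summit.HubbardSuperconductivity.HubbardSuperconductivity.Theorems.DispersionFlow
open Summit.HubbardSuperconductivity.HubbardSuperconductivity.Theorems.PerturbedFermiCurve
open Summit.HubbardSuperconductivity.HubbardSuperconductivity.Theorems.KLRegimeSplit
open Summit.HubbardSuperconductivity.HubbardSuperconductivity.Theorems.TwoPointAssembly
open Summit.HubbardSuperconductivity.HubbardSuperconductivity.Theorems.TwoVolumeDefect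
open Summit.HubbardSuperconductivity.HubbardSuperconductivity.Theorems.TwoLegFourier

/-! ## §3 GENERIC-THRESHOLD FORM ((R60g)(4): the currency literals as CLOSED (P R)-terms `klZt/klZs1/klZs2` with U-rows, no «≤ 2⁴⁰-literal» fit) -/

/-- **THE MIXED-CURRENCY B-FITS BELOW THE GENERIC DOOR** `U ≤ klTwoLegMomU R Zt Zs₂` + the #28 row: `Zt·U² ≤ cz·|U|` (B1′) and
`Zs₁·ĉ·|U| + Zs₂·U² + 4/3·Gfr₁·U² ≤ cz·|U|·cDtmin(−1.2,−0.05)/2` (B2′) — no sign or size hypothesis on `Zt`, `Zs₂`. -/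
theorem mixed_fits_of_le_klTwoLegMomU {R : RenConsts} (hcz : 0 < R.cz) {U c Zt Zs₁ Zs₂ : ℝ} (hU : 0 < U)
    (hUm : U ≤ klTwoLegMomU R Zt Zs₂) (hrow : Zs₁ * (c / Real.log 4 + U ^ 2) ≤ R.cz / 600) :
    Zt * U ^ 2 ≤ R.cz * |U| ∧
      Zs₁ * (c / Real.log 4 + U ^ 2) * |U| + Zs₂ * U ^ 2 + 4 / 3 * R.Gfr 1 * U ^ 2 ≤ R.cz * |U| * (cDtmin (-1.2) (-0.05) / 2) := by
  have hD0 : 0 < 2 * (|Zt| + |Zs₂|) + 4 / 3 * |R.Gfr 1| + 1 := by positivity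
  have habs : |U| = U := abs_of_pos hU
  have h2' : U * (2 * (|Zt| + |Zs₂|) + 4 / 3 * |R.Gfr 1| + 1) ≤ R.cz * (23 / 200) := (le_div_iff₀ hD0).1 hUm
  have hZt := le_abs_self Zt
  have hZs := le_abs_self Zs₂
  have hG := le_abs_self (R.Gfr 1)
  have hZs0 := abs_nonneg Zs₂
  have hZt0 := abs_nonneg Zt
  have hG0 := abs_nonneg (R.Gfr 1)
  rw [habs]
  refine ⟨by nlinarith [hU.le], ?_⟩
  have h7' : R.cz * U * (7 / 60) ≤ R.cz * U * (cDtmin (-1.2) (-0.05) / 2) :=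
    mul_le_mul_of_nonneg_left seven_div_sixty_le_half_cDtmin_wide (by positivity)
  have hA : Zs₁ * (c / Real.log 4 + U ^ 2) * U ≤ R.cz * U * (1 / 600) := by
    calc Zs₁ * (c / Real.log 4 + U ^ 2) * U ≤ R.cz / 600 * U := mul_le_mul_of_nonneg_right hrow hU.le
      _ = R.cz * U * (1 / 600) := by ring
  have hB : Zs₂ * U ^ 2 + 4 / 3 * R.Gfr 1 * U ^ 2 ≤ R.cz * U * (23 / 200) := by nlinarith [hU.le]
  calc Zs₁ * (c / Real.log 4 + U ^ 2) * U + Zs₂ * U ^ 2 + 4 / 3 * R.Gfr 1 * U ^ 2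
      = Zs₁ * (c / Real.log 4 + U ^ 2) * U + (Zs₂ * U ^ 2 + 4 / 3 * R.Gfr 1 * U ^ 2) := by ring
    _ ≤ R.cz * U * (1 / 600) + R.cz * U * (23 / 200) := add_le_add hA hB
    _ = R.cz * U * (7 / 60) := by ring
    _ ≤ R.cz * U * (cDtmin (-1.2) (-0.05) / 2) := h7'

/-- **THE MIXED-CURRENCY NESTED-LEG SMALLNESS BELOW GENERIC DOORS**: `Zs₁·ĉ ≤ 1/10`, `U ≤ 1/(64·(|Zs₂|+1))`, `U ≤ klCurveU0 R` ⇒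
`(Zs₁·ĉ/|U| + Zs₂)·U² + 4/3·Gfr₁·U² ≤ klCurveD`. -/
theorem twoLeg_gridLegSmallnessC_of_generic_doors {R : RenConsts} (hG0 : 0 ≤ R.Gfr 0) (hG1 : 0 ≤ R.Gfr 1) {U c Zs₁ Zs₂ : ℝ} (hU : 0 < U)
    (hUq : U ≤ 1 / (64 * (|Zs₂| + 1))) (hUc : U ≤ klCurveU0 R) (hrow : Zs₁ * (c / Real.log 4 + U ^ 2) ≤ 1 / 10) :
    (Zs₁ * (c / Real.log 4 + U ^ 2) / |U| + Zs₂) * U ^ 2 + 4 / 3 * R.Gfr 1 * U ^ 2 ≤ klCurveD := by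
  rw [mixedSpaceBudget_mul_sq hU.ne']
  have hUone : U ≤ 1 := hUc.trans (klCurveU0_le_one R)
  have habs : |U| = U := abs_of_pos hU
  have h1 : Zs₁ * (c / Real.log 4 + U ^ 2) * |U| ≤ 1 / 10 := by
    rw [habs]
    calc Zs₁ * (c / Real.log 4 + U ^ 2) * U ≤ 1 / 10 * U := mul_le_mul_of_nonneg_right hrow hU.le
      _ ≤ 1 / 10 * 1 := mul_le_mul_of_nonneg_left hUone (by norm_num)
      _ = 1 / 10 := by ring
  have hZ := le_abs_self Zs₂
  have hZ0 := abs_nonneg Zs₂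
  have hD64 : 0 < 64 * (|Zs₂| + 1) := by positivity
  have hq : U * (64 * (|Zs₂| + 1)) ≤ 1 := (le_div_iff₀ hD64).1 hUq
  have h2 : Zs₂ * U ^ 2 ≤ 1 / 64 := by nlinarith [hU.le]
  have hκ5 : klCurveKappa ≤ 1 / 5 := min_le_right _ _
  have hGU : R.Gfr 1 * U ≤ 1 / 120 := by
    have hden : 0 < 24 * (R.Gfr 0 + R.Gfr 1 + 1) := by positivity
    have hU2 : U ≤ klCurveKappa / (24 * (R.Gfr 0 + R.Gfr 1 + 1)) := hUc.trans (min_le_right _ _)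
    have h1' : U * (24 * (R.Gfr 0 + R.Gfr 1 + 1)) ≤ klCurveKappa := (le_div_iff₀ hden).1 hU2
    nlinarith [mul_nonneg hG0 hU.le, hU.le]
  have h3 : 4 / 3 * R.Gfr 1 * U ^ 2 ≤ 1 / 90 := by
    have h1' : R.Gfr 1 * U ^ 2 ≤ R.Gfr 1 * U := by
      have : U ^ 2 ≤ U := by nlinarith
      exact mul_le_mul_of_nonneg_left this hG1
    nlinarith
  have hD : (33 : ℝ) / 200 ≤ klCurveD := by unfold klCurveD; linarith [cDtmin_window_ge]
  linarith

/-- **STUB (e) UNDER (T′-B), GENERIC-THRESHOLD FORM, MODULO THE VL ROWS** ((R60g)(4): the currency literals are CLOSED (P R)-terms — `klZt`, `klZs1`, `klZs2` —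
whatever their size; NO «≤ 2⁴⁰-literal» fit): as `stub_twoLeg_step_of_gridBinderC_dualRows_raise` with the rows `hZa`/`hS₂a` REPLACED by two U-rows
`hUm : U ≤ klTwoLegMomU R Zt Zs₂` (the landed generic door, …TwoLegMomentsExport §2a) and `hUq : U ≤ 1/(64·(|Zs₂|+1))` — both fold into `klEngU₀11`'s
min-list as components keyed on the literal defs — plus the #28 row `hrow`. -/
theorem stub_twoLeg_step_of_gridBinderC_dualRows_raise_thr (P : SplitConsts) (R : RenConsts) (c : ℝ) (Q : EngConsts)
    (hQ : (klEngQ7 P R).IsRaiseOf Q) (cJ : ℕ → ℝ) (hC : ∀ k, cJ k ≤ klEngGeo7.S k) (hP : P.WF) (hR : R.WF2) (hc : 0 < c)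
    (hc3 : c ≤ klEngC₃6 P R) (μ : ℝ) (hμ : μ ∈ klWindowC) (U : ℝ) (hU : 0 < U) (hUle : U ≤ klEngU₀10 P R c) (β : ℝ) (hβ : klBetaMin ≤ β)
    (hβc : β ≤ Real.exp (c / U ^ 2)) (L M : ℕ) [NeZero L] [NeZero M] (hL : klEngL₄ P R β U ≤ L) (hM : klEngM₃ β U L ≤ M)
    (n : ℕ) (hn1 : 1 ≤ n) (hn : n ≤ nScales β + 1) (hreg : IsKLRegime U c (-(n : ℤ)))
    (hhist : HistP klPredsV17F2 L M klEngGeo8 P Q R β U μ 0 n)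
    (hfr : FrameOK R U (nScales β) μ (klFlowFrameU L M β U μ n))
    (hE : EngineBoundsAtV17F2 L M klEngGeo8 P Q β U μ n)
    (hJ : TwoLegReadJetBound L M cJ (klC4aJetC' P R) β U μ (klFlowFrameU L M β U μ n) n)
    {Zt Zs₁ Zs₂ : ℝ} (hUm : U ≤ klTwoLegMomU R Zt Zs₂) (hUq : U ≤ 1 / (64 * (|Zs₂| + 1)))
    (hrow : Zs₁ * (c / Real.log 4 + U ^ 2) ≤ min (R.cz / 600) (1 / 10))
    (hGs : ∀ n' ≤ n, ∀ (L₁ M₁ : ℕ) [NeZero L₁] [NeZero M₁], L ≤ L₁ → Q.M0 β L₁ ≤ M₁ →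
      (∀ j < n', histV17F2 L₁ M₁ klEngGeo8 P Q R β U μ j ∧ TwoLegSlopes L₁ M₁ R β U μ (klFlowFrameU L₁ M₁ β U μ j) j) →
        TwoLegGridMomentsAtC L₁ M₁ Zt Zs₁ Zs₂ c β U μ (klFlowFrameU L₁ M₁ β U μ n') n')
    {d : ℝ} (hd : 0 ≤ d) (hdCL : d ≤ Q.CL β 0 / 4) {Dd Df Dc : ℕ → ℝ}
    (hDsum : ∀ n' ≤ n, Dd n' + Df n' ≤ d * (4 : ℝ) ^ n' / 3) (hDc : ∀ n' ≤ n, Dc n' ≤ d * (4 : ℝ) ^ n' / 3)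
    (hdualSp : ∀ n' ≤ n, ∀ (Mq : ℕ → ℕ) (L₁ L₂ M₂ : ℕ) [NeZero L₁] [NeZero L₂] [NeZero M₂], L ≤ L₁ → L₁ ∣ L₂ → Q.M0 β L₁ ≤ M₂ →
      Mq L₁ ≤ M₂ → Q.M0 β L₂ ≤ M₂ → Mq L₂ ≤ M₂ →
      (∀ j < n', histV17F2 L₁ M₂ klEngGeo8 P Q R β U μ j ∧ TwoLegSlopes L₁ M₂ R β U μ (klFlowFrameU L₁ M₂ β U μ j) j) →
      (∀ j < n', histV17F2 L₂ M₂ klEngGeo8 P Q R β U μ j ∧ TwoLegSlopes L₂ M₂ R β U μ (klFlowFrameU L₂ M₂ β U μ j) j) →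
      (∀ m < n', ∀ θ : ℝ, |klLocalPart L₁ M₂ β U μ (klFlowFrameU L₁ M₂ β U μ m) m θ -
        klLocalPart L₂ M₂ β U μ (klFlowFrameU L₂ M₂ β U μ m) m θ| ≤ d * (4 : ℝ) ^ m / L₁) →
      (∀ q : Fin 2 → ℝ, |(klFlowFrameU L₁ M₂ β U μ n').eval q - (klFlowFrameU L₂ M₂ β U μ n').eval q| ≤
        (∑ m ∈ range n', d * (4 : ℝ) ^ m) / L₁) →
      ∃ (oc : SpaceTimeIdx L₁ M₂) (of : SpaceTimeIdx L₂ M₂),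
        (∀ m ∈ ({omega0 M₂, (omega0 M₂).rev} : Finset (MatsubaraIdx M₂)), ∀ σ : Fin 2, imagTimeWeight β M₂ * ∑ ybar : TorusSite 2 L₁,
          (‖(∑ t₁ : ImagTimeIdx M₂,
              sectorisedKernel L₁ M₂ β (trivialMultiplier L₁ M₂)
                  (klEffectiveAction L₁ M₂ β U μ (klFlowFrameU L₁ M₂ β U μ n') klE0 n' - counterQuadratic L₁ M₂ β (klFlowFrameU L₁ M₂ β U μ n')) 2
                  (![((0, σ), 0), ((0, σ), 1)] : Fin 2 → SectorLeg 1) ![oc, (t₁, oc.2 + ybar)] *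
                Complex.exp (((matsubaraFreq β M₂ m * (imagTime β M₂ oc.1 - imagTime β M₂ t₁) : ℝ) : ℂ) * I)) -
            (∑ t₁ : ImagTimeIdx M₂,
              sectorisedKernel L₂ M₂ β (trivialMultiplier L₂ M₂)
                  (klEffectiveAction L₂ M₂ β U μ (klFlowFrameU L₂ M₂ β U μ n') klE0 n' - counterQuadratic L₂ M₂ β (klFlowFrameU L₂ M₂ β U μ n')) 2
                  (![((0, σ), 0), ((0, σ), 1)] : Fin 2 → SectorLeg 1) ![of, (t₁, of.2 + Torus.proj L₂ (Torus.cRep ybar))] *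
                Complex.exp (((matsubaraFreq β M₂ m * (imagTime β M₂ of.1 - imagTime β M₂ t₁) : ℝ) : ℂ) * I))‖ +
          ‖(∑ t₁ : ImagTimeIdx M₂,
              sectorisedKernel L₁ M₂ β (trivialMultiplier L₁ M₂)
                  (klEffectiveAction L₁ M₂ β U μ (klFlowFrameU L₁ M₂ β U μ n') klE0 n' - counterQuadratic L₁ M₂ β (klFlowFrameU L₁ M₂ β U μ n')) 2
                  (![((0, σ), 0), ((0, σ), 1)] : Fin 2 → SectorLeg 1) ![oc, (t₁, oc.2 + -ybar)] *
                Complex.exp (((matsubaraFreq β M₂ m * (imagTime β M₂ oc.1 - imagTime β M₂ t₁) : ℝ) : ℂ) * I)) -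
            (∑ t₁ : ImagTimeIdx M₂,
              sectorisedKernel L₂ M₂ β (trivialMultiplier L₂ M₂)
                  (klEffectiveAction L₂ M₂ β U μ (klFlowFrameU L₂ M₂ β U μ n') klE0 n' - counterQuadratic L₂ M₂ β (klFlowFrameU L₂ M₂ β U μ n')) 2
                  (![((0, σ), 0), ((0, σ), 1)] : Fin 2 → SectorLeg 1) ![of, (t₁, of.2 + -Torus.proj L₂ (Torus.cRep ybar))] *
                Complex.exp (((matsubaraFreq β M₂ m * (imagTime β M₂ of.1 - imagTime β M₂ t₁) : ℝ) : ℂ) * I))‖) ≤ Dd n' / L₁) ∧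
        (∀ m ∈ ({omega0 M₂, (omega0 M₂).rev} : Finset (MatsubaraIdx M₂)), ∀ σ : Fin 2, imagTimeWeight β M₂ *
          ∑ y ∈ univ.filter (fun y : TorusSite 2 L₂ => Torus.proj L₂ (Torus.cRep (fun i => (((y i).val : ℕ) : ZMod L₁))) ≠ y),
          (‖(∑ t₁ : ImagTimeIdx M₂,
              sectorisedKernel L₂ M₂ β (trivialMultiplier L₂ M₂)
                  (klEffectiveAction L₂ M₂ β U μ (klFlowFrameU L₂ M₂ β U μ n') klE0 n' - counterQuadratic L₂ M₂ β (klFlowFrameU L₂ M₂ β U μ n')) 2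
                  (![((0, σ), 0), ((0, σ), 1)] : Fin 2 → SectorLeg 1) ![of, (t₁, of.2 + y)] *
                Complex.exp (((matsubaraFreq β M₂ m * (imagTime β M₂ of.1 - imagTime β M₂ t₁) : ℝ) : ℂ) * I))‖ +
          ‖(∑ t₁ : ImagTimeIdx M₂,
              sectorisedKernel L₂ M₂ β (trivialMultiplier L₂ M₂)
                  (klEffectiveAction L₂ M₂ β U μ (klFlowFrameU L₂ M₂ β U μ n') klE0 n' - counterQuadratic L₂ M₂ β (klFlowFrameU L₂ M₂ β U μ n')) 2
                  (![((0, σ), 0), ((0, σ), 1)] : Fin 2 → SectorLeg 1) ![of, (t₁, of.2 + -y)] *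
                Complex.exp (((matsubaraFreq β M₂ m * (imagTime β M₂ of.1 - imagTime β M₂ t₁) : ℝ) : ℂ) * I))‖) ≤ Df n' / L₁))
    (hdualCut : ∀ n' ≤ n, ∀ (Mq : ℕ → ℕ) (L₁ M₁ M₂ : ℕ) [NeZero L₁] [NeZero M₁] [NeZero M₂], L ≤ L₁ → Q.M0 β L₁ ≤ M₁ → Mq L₁ ≤ M₁ →
      M₁ ≤ M₂ →
      (∀ j < n', histV17F2 L₁ M₁ klEngGeo8 P Q R β U μ j ∧ TwoLegSlopes L₁ M₁ R β U μ (klFlowFrameU L₁ M₁ β U μ j) j) →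
      (∀ j < n', histV17F2 L₁ M₂ klEngGeo8 P Q R β U μ j ∧ TwoLegSlopes L₁ M₂ R β U μ (klFlowFrameU L₁ M₂ β U μ j) j) →
      (∀ m < n', ∀ θ : ℝ, |klLocalPart L₁ M₁ β U μ (klFlowFrameU L₁ M₁ β U μ m) m θ -
        klLocalPart L₁ M₂ β U μ (klFlowFrameU L₁ M₂ β U μ m) m θ| ≤ d * (4 : ℝ) ^ m / L₁) →
      (∀ q : Fin 2 → ℝ, |(klFlowFrameU L₁ M₁ β U μ n').eval q - (klFlowFrameU L₁ M₂ β U μ n').eval q| ≤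
        (∑ m ∈ range n', d * (4 : ℝ) ^ m) / L₁) →
      ∃ (o₁ : SpaceTimeIdx L₁ M₁) (o₂ : SpaceTimeIdx L₁ M₂),
        (∀ σ : Fin 2, ∑ y : TorusSite 2 L₁,
          (‖(imagTimeWeight β M₁ : ℂ) * (∑ t₁ : ImagTimeIdx M₁,
              sectorisedKernel L₁ M₁ β (trivialMultiplier L₁ M₁)
                  (klEffectiveAction L₁ M₁ β U μ (klFlowFrameU L₁ M₁ β U μ n') klE0 n' - counterQuadratic L₁ M₁ β (klFlowFrameU L₁ M₁ β U μ n')) 2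
                  (![((0, σ), 0), ((0, σ), 1)] : Fin 2 → SectorLeg 1) ![o₁, (t₁, o₁.2 + y)] *
                Complex.exp (((matsubaraFreq β M₁ (omega0 M₁) * (imagTime β M₁ o₁.1 - imagTime β M₁ t₁) : ℝ) : ℂ) * I)) -
            (imagTimeWeight β M₂ : ℂ) * (∑ t₁ : ImagTimeIdx M₂,
              sectorisedKernel L₁ M₂ β (trivialMultiplier L₁ M₂)
                  (klEffectiveAction L₁ M₂ β U μ (klFlowFrameU L₁ M₂ β U μ n') klE0 n' - counterQuadratic L₁ M₂ β (klFlowFrameU L₁ M₂ β U μ n')) 2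
                  (![((0, σ), 0), ((0, σ), 1)] : Fin 2 → SectorLeg 1) ![o₂, (t₁, o₂.2 + y)] *
                Complex.exp (((matsubaraFreq β M₂ (omega0 M₂) * (imagTime β M₂ o₂.1 - imagTime β M₂ t₁) : ℝ) : ℂ) * I))‖ +
          ‖(imagTimeWeight β M₁ : ℂ) * (∑ t₁ : ImagTimeIdx M₁,
              sectorisedKernel L₁ M₁ β (trivialMultiplier L₁ M₁)
                  (klEffectiveAction L₁ M₁ β U μ (klFlowFrameU L₁ M₁ β U μ n') klE0 n' - counterQuadratic L₁ M₁ β (klFlowFrameU L₁ M₁ β U μ n')) 2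
                  (![((0, σ), 0), ((0, σ), 1)] : Fin 2 → SectorLeg 1) ![o₁, (t₁, o₁.2 + -y)] *
                Complex.exp (((matsubaraFreq β M₁ (omega0 M₁) * (imagTime β M₁ o₁.1 - imagTime β M₁ t₁) : ℝ) : ℂ) * I)) -
            (imagTimeWeight β M₂ : ℂ) * (∑ t₁ : ImagTimeIdx M₂,
              sectorisedKernel L₁ M₂ β (trivialMultiplier L₁ M₂)
                  (klEffectiveAction L₁ M₂ β U μ (klFlowFrameU L₁ M₂ β U μ n') klE0 n' - counterQuadratic L₁ M₂ β (klFlowFrameU L₁ M₂ β U μ n')) 2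
                  (![((0, σ), 0), ((0, σ), 1)] : Fin 2 → SectorLeg 1) ![o₂, (t₁, o₂.2 + -y)] *
                Complex.exp (((matsubaraFreq β M₂ (omega0 M₂) * (imagTime β M₂ o₂.1 - imagTime β M₂ t₁) : ℝ) : ℂ) * I))‖) ≤ Dc n' / L₁) ∧
        (∀ σ : Fin 2, ∑ y : TorusSite 2 L₁,
          (‖(imagTimeWeight β M₁ : ℂ) * (∑ t₁ : ImagTimeIdx M₁,
              sectorisedKernel L₁ M₁ β (trivialMultiplier L₁ M₁)
                  (klEffectiveAction L₁ M₁ β U μ (klFlowFrameU L₁ M₁ β U μ n') klE0 n' - counterQuadratic L₁ M₁ β (klFlowFrameU L₁ M₁ β U μ n')) 2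
                  (![((0, σ), 0), ((0, σ), 1)] : Fin 2 → SectorLeg 1) ![o₁, (t₁, o₁.2 + y)] *
                Complex.exp (((matsubaraFreq β M₁ (omega0 M₁).rev * (imagTime β M₁ o₁.1 - imagTime β M₁ t₁) : ℝ) : ℂ) * I)) -
            (imagTimeWeight β M₂ : ℂ) * (∑ t₁ : ImagTimeIdx M₂,
              sectorisedKernel L₁ M₂ β (trivialMultiplier L₁ M₂)
                  (klEffectiveAction L₁ M₂ β U μ (klFlowFrameU L₁ M₂ β U μ n') klE0 n' - counterQuadratic L₁ M₂ β (klFlowFrameU L₁ M₂ β U μ n')) 2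
                  (![((0, σ), 0), ((0, σ), 1)] : Fin 2 → SectorLeg 1) ![o₂, (t₁, o₂.2 + y)] *
                Complex.exp (((matsubaraFreq β M₂ (omega0 M₂).rev * (imagTime β M₂ o₂.1 - imagTime β M₂ t₁) : ℝ) : ℂ) * I))‖ +
          ‖(imagTimeWeight β M₁ : ℂ) * (∑ t₁ : ImagTimeIdx M₁,
              sectorisedKernel L₁ M₁ β (trivialMultiplier L₁ M₁)
                  (klEffectiveAction L₁ M₁ β U μ (klFlowFrameU L₁ M₁ β U μ n') klE0 n' - counterQuadratic L₁ M₁ β (klFlowFrameU L₁ M₁ β U μ n')) 2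
                  (![((0, σ), 0), ((0, σ), 1)] : Fin 2 → SectorLeg 1) ![o₁, (t₁, o₁.2 + -y)] *
                Complex.exp (((matsubaraFreq β M₁ (omega0 M₁).rev * (imagTime β M₁ o₁.1 - imagTime β M₁ t₁) : ℝ) : ℂ) * I)) -
            (imagTimeWeight β M₂ : ℂ) * (∑ t₁ : ImagTimeIdx M₂,
              sectorisedKernel L₁ M₂ β (trivialMultiplier L₁ M₂)
                  (klEffectiveAction L₁ M₂ β U μ (klFlowFrameU L₁ M₂ β U μ n') klE0 n' - counterQuadratic L₁ M₂ β (klFlowFrameU L₁ M₂ β U μ n')) 2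
                  (![((0, σ), 0), ((0, σ), 1)] : Fin 2 → SectorLeg 1) ![o₂, (t₁, o₂.2 + -y)] *
                Complex.exp (((matsubaraFreq β M₂ (omega0 M₂).rev * (imagTime β M₂ o₂.1 - imagTime β M₂ t₁) : ℝ) : ℂ) * I))‖) ≤ Dc n' / L₁)) :
    TwoLegStepV17F2 L M klEngGeo8 P Q R β U μ n := by
  have _ := hP; have _ := hn1; have _ := hreg; have _ := hE
  have hRge : ∀ j, 0 ≤ R.Gfr j := hR.1.2.2
  have hcz : 0 < R.cz := hR.2.2
  have hcle : c ≤ klCurveC3 R := hc3.trans ((klEngC₃6_le_klEngC₃3 P R).trans (klEngC₃3_le_klCurveC3 P hRge))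
  have hc33 : c ≤ klEngC₃3 P R := hc3.trans (klEngC₃6_le_klEngC₃3 P R)
  have hU9 : U ≤ klEngU₀9 P R c := hUle.trans (klEngU₀10_le_klEngU₀9 P R c)
  have hU4 : U ≤ klEngU₀4 P R c := hUle.trans (klEngU₀10_le_klEngU₀4 P R c)
  have hU3 : U ≤ klEngU₀3 P R c := hU9.trans (klEngU₀9_le_klEngU₀3 P R c)
  have hUc : U ≤ klCurveU0 R := hU3.trans (klEngU₀3_le_klCurveU0 P hRge c)
  have hL3 : klEngL₃ β U ≤ L := klEngL₃_le_of_klEngL₄_le hL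
  have h0 : FrameOK R U (nScales β) μ 0 := klFrameOK_zeroC hR.1 U (nScales β) hμ
  have hβ0 : 0 < β := lt_of_lt_of_le (by norm_num [klBetaMin]) hβ
  have hU0 : U ≠ 0 := hU.ne'
  have hCL : ∀ n' ≤ n, Q.CL β 0 * (4 : ℝ) ^ n' ≤ Q.CL β n' := fun n' _ => le_of_eq (by
    rw [hQ.CL_eq, klEngQ7_CL_apply, klEngQ7_CL_apply]; ring)
  have hM0 : Q.M0 β L ≤ M := by rw [hQ.M0_eq]; exact hM
  have hGS : ∀ k, cJ k ≤ klEngGeo8.S k := fun k => by rw [klEngGeo8_S]; exact hC k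
  have hQS : ∀ k, klC4aJetC' P R k ≤ Q.S' k := fun k => by rw [hQ.S'_eq]; exact klC4aJetC'_le_klEngQ7_S' P R k
  have hQCL : 0 ≤ Q.CL β n := by rw [hQ.CL_eq]; exact klEngQ7_CL_nonneg P R β n
  have hrow600 : Zs₁ * (c / Real.log 4 + U ^ 2) ≤ R.cz / 600 := hrow.trans (min_le_left _ _)
  have hrow10 : Zs₁ * (c / Real.log 4 + U ^ 2) ≤ 1 / 10 := hrow.trans (min_le_right _ _)
  have hgridC : TwoLegGridFlowMomentsAtC L M Zt Zs₁ Zs₂ c β U μ n :=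
    hGs n le_rfl L M le_rfl hM0 (fun j hj => ⟨histV17F2_of_histP hhist j hj, ((histP_klPredsV17F2_iff L M klEngGeo8 P Q R β U μ 0 n).1 hhist j hj).2.2.2.2.1⟩)
  have hgrid : TwoLegGridFlowMomentsAt L M Zt (Zs₁ * (c / Real.log 4 + U ^ 2) / |U| + Zs₂) β U μ n := hgridC.toFlowMomentsAt hU0
  obtain ⟨-, hZs0⟩ := hgrid.budget_nonneg hβ0 hU0
  have hsmall := twoLeg_gridLegSmallnessC_of_generic_doors (c := c) (Zs₁ := Zs₁) (Zs₂ := Zs₂) (hRge 0) (hRge 1) hU hUq hUc hrow10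
  have hsp := spLeg_allScales_of_gridMoments_V17F2_geometric4 (G := klEngGeo8) (P := P) hRge hc hcle hU hUc hβ hβc hμ hL3 h0 hn hd hdCL hCL
    hZs0 hsmall hDsum (fun n'' hn'' Mq L₁ L₂ M₂ _ _ _ hLL₁ _ hM₁ _ _ _ hh₁ _ _ _ => (hGs n'' hn'' L₁ M₂ hLL₁ hM₁ hh₁).toMomentsAt hU0) hdualSp n le_rfl
  have hcut := cutLeg_allScales_of_gridMoments_V17F2_geometric4 (G := klEngGeo8) (P := P) hRge hc hcle hU hUc hβ hβc hμ hL3 h0 hn hd hdCL hCL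
    hZs0 hsmall hDc (fun n'' hn'' Mq L₁ M₁ M₂ _ _ _ hLL₁ hM₁ _ _ hh₁ _ _ _ => (hGs n'' hn'' L₁ M₁ hLL₁ hM₁ hh₁).toMomentsAt hU0) hdualCut n le_rfl
  obtain ⟨hzt, hms⟩ := twoLeg_slopeSizes_of_twoLegGridMomentsAtC hβ0 hU0 ((twoLegGridFlowMomentsAtC_iff Zt Zs₁ Zs₂ c β U μ n).1 hgridC)
  obtain ⟨hfitT, hfit1⟩ := mixed_fits_of_le_klTwoLegMomU (c := c) (Zs₁ := Zs₁) hcz hU hUm hrow600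
  have hz : ∀ k ∈ klShell L μ (klFlowFrameU L M β U μ n) n,
      |klFieldStrength L M β U μ (klFlowFrameU L M β U μ n) n k - 1| ≤ R.cz * |U| := fun k _ => (hzt k).trans hfitT
  exact twoLegStepV17F2_of_jets_sepTubeGradient_nestedLegs_pkg klEngGeo8 Q P hR hc hc33 hμ hU hU4 hβ hβc hL3 hn hfr hQCL hGS hQS hJ.1 hJ.2 hz
    (fun q _ => hms q) hfit1 hcut hsp


end Summit.HubbardSuperconductivity.HubbardSuperconductivity.Theorems.EngineV8

end
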